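import Summits.Ventures.HSemireg.AmplificationChainG4SigmaLadder
import Summits.Ventures.HSemireg.AmplificationChainVersalChartEGAFree
import Summits.Ventures.HSemireg.PerfectComplexSigmaDoor
import Summits.Ventures.HSemireg.MarkmanClassStatementTower
import HarnessLib

/-!
# Venture HSemireg — the amplification chain ASSEMBLED AT LEVEL `g = 2N` (every `N`): route (C)'s census-row forms with every
# binder a real carrier, in each door currency the tree has (rank door · σ-door · rung R5 of the trust-base ladder), and what ONE
# such row settles — the split `2N`-folds of its field, and (the LADDER) every Weil-type `2n`-fold of that field below it, `n < N`,
# every discriminant class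

HONEST FRAMING. Lean index of the computation cell `pub-hsemireg` (seat p11, «Sunday typer — assembly, g = 2n»; written from the
SIGNED `target-g6/VERDICT-G6.md` v1.0 `1651dcc7322662a2` and `general-structure/STRUCTURE.md` v1.0-SIGNED §2 (S1)–(S5) / §3.0–3.1).
NOTHING about any explicit variety is asserted; every published input is a hypothesis BY NAME, every object and number a hypothesis
BY VALUE. Nothing here says HC, HC_CM or HC_AV is proved. The signed verdict is «NO-in-families-tried» at `g = 6` (non-split
components) and at `g = 8`, YES as METHOD INSTANCES on split components (`g = 4` = STEP-0, `g = 6` split) and «STRUCTURAL-NO NOT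
CLAIMED»: accordingly NO row below is instantiated by the cell on a deciding component, and NO negative theorem about all objects is
stated. 0 `sorry`, 0 `def`, 0 new named fact; every proof is a composition of landed theorems of seats p4 / p5 / p7 / t-7 / th-2 /
th-3 / lit-3 and the Hodge summit's Weil ladder.

## What this file adds (uniform in the level `N`; the `g = 4` rows of `AmplificationChainG4RouteC.lean` §5,
`AmplificationChainG4Transport.lean` §3, `PerfectComplexSigmaDoor.lean` §3 and `AmplificationChainG4SigmaLadder.lean` §4 are the case `N = 2`)

§1 SEEDS FROM A CENSUS ROW, any level `N`, every binder a real carrier: `hasSeedOn_rankObjClass_of_complex` (p4's rank door: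
   `Ext^{<0} = 0`, `Hom = ℂ`, `rank Ext² ≤ r(P, ch E)`), `hasSeedOn_sigmaObjClass_of_complex` (t-7's σ-door: `(σ_q)_{q+1∈I}` jointly
   injective on the real `σ`-carrier), and the anchor packaging `hasHyperbolicSeedOn_of_hasSeedOn` (split anchor ∧ seed ⟹ hyperbolic
   seed) — so that every BUNDLED theorem of the venture (`…_of_hyperbolicSeedOn`, `…_of_seedOn_member`, p5's tower) reads on a row.
§2 THE `g = 2N` CONDITIONAL THEOREM, rank door (STRUCTURE §3.0 «THE LADDER» + §3.1 (S-A), kernel form):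
   `ladder_of_reach_of_perfectComplexRankTransfer_of_complex` — BY NAME `weilFamilyReach_hyperbolic` (Deligne, REFEREED) and
   `PerfectComplexRankTransfer C` (ASSUMPTION of the venture; printed strength ON PAPER only: [BuchweitzFlenner2008HH] Prop. 6.4.4 for
   the rank leg — this is where STRUCTURE's (S2) «`δ_E = 0` ⟹ `σ_E` injective» enters — and [Perry2022] Prop. 8.1 /
   [Pridham2024Semiregularity] Cor. 2.25, Rem. 2.27 / [Lieblich2006] for the transfer of a COMPLEX; the kernel links it to none of
   them, F-1); BY VALUE one rank-admissible bounded complex of vector bundles with Markman's class shape on a SPLIT `√-d`-Weil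
   `2N`-fold ⟹ (i) `Stubs.WeilAlgebraicSplitHyperplane N d` (every split `√-d`-Weil `2N`-fold), (ii) `WeilAlgebraicAll n d` for every
   `2 ≤ n < N` (EVERY `√-d`-Weil `2n`-fold, every discriminant — Schoen's descent, PROVED in the tree), (iii) every cell
   `WeilClassesComponent n d δ`, `n < N`. DECIDING-ROW form (a member of ANY cell `(N, d, δ)`, reach-by-similitude
   `weilFamilyReach_similar`): `weilClassesComponent_of_perfectComplexRankTransfer_of_complex`.
§3 The same over the σ-door (`PerfectComplexSigmaTransfer C`, printed object hypothesis on t-7's real carrier).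
§4 The same on rung R5 of the trust-base ladder: BY NAME `weilFamilyReach_hyperbolic` ∧ `PridhamPerfectLifts C` ([Pridham2024]
   Cor. 2.25 + Rem. 2.27/2.21 + Lemma 1.8–1.9, venture-typed, undischarged) ∧ Lieblich-type versal charts (`HasVersalPerfectChartAt`,
   assumption by name; EGA IV 17 DISCHARGED by lit-3's theorems) — nothing else.
§5 The functor-free `Ext`-transport variant (the census computes `Ext^•` on a SOURCE object `G`, e.g. `I_Z` before a Fourier–Mukai
   functor): `hasSeedOn_rankObjClass_of_extRank_eq`.

READINGS BY `g` (VERDICT-G6 v1.0, words of record): `N = 2` — g = 4 «YES (method instances)» = the STEP-0 rows, in the tree under the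
`g = 4` names above; `N = 3` split — the g = 6 METHOD INSTANCES (theta-secant `E_m ⊗ M`, rank `48 = 48`; triangle sheaf C13-8 …)
would instantiate §2/§3 at `N = 3`, giving the split sixfolds ([Markman2025SecantWeil] Thm. 1.5.1, re-derived) AND `WeilAlgebraicAll 2 d`
(every `√-d`-Weil fourfold, every discriminant — [Markman2025SecantWeil] Cor. 1.6.1 / Markman's ICM survey Thm. 1.2, re-derived);
`N = 3` non-split — the DECIDING rows: 0 objects, nothing instantiated; `N = 4` — § g = 8 «NO-in-families-tried»: a pass would give
every sixfold cell of its `K` (`MarkmanClassStatementTower.lean` §1); `N = 5` — § g = 10 appendix «family S: no witness»: a pass would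
give `WeilAlgebraicAll 4 d ∧ 3 d ∧ 2 d`. The companion file `StructureLadderG2n.lean` EVALUATES `r(P, ch E) = 6N² − 2N` from the class
shape (STRUCTURE §1 column, (S1)) so that the rank clause reads «`dim Ext²(E,E) ≤ 6N² − 2N`» = EXTREMAL (`δ_E = 0`, (S2)/(S4)).

References: [Deligne1982HodgeCycles] proof of Thm. 4.8; [Schoen1998HodgeWeilAddendum] §10; [vanGeemen1994HodgeAV] 4.14, 5.2–5.4;
[BuchweitzFlenner2003] Def. 4.1, §5; [BuchweitzFlenner2008HH] Prop. 6.4.4; [Perry2022] Prop. 8.1; [Pridham2024Semiregularity] Cor. 2.25,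
Rem. 2.27, Rem. 2.21, Lemma 1.8–1.9; [Lieblich2006] Thm. 4.2.1, Prop. 2.1.9; [EGAIV4] Prop. (17.14.2), Cor. (17.16.3) (i);
[Markman2025SecantWeil] arXiv:2502.03415 §1.1, Thm. 1.5.1, Cor. 1.6.1 (preprint); [Markman2025SurveySecant] arXiv:2509.23403 §4, §11.5, Thm. 1.2
(survey); [Markman2023GeneralizedKummers] J. Eur. Math. Soc. 25 (2023) Thm. 1.5 (= Thm. 13.4), p. 236.
-/

noncomputable section

open CategoryTheory CategoryTheory.Limits AlgebraicGeometry Set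
open Literature.AlgebraicGeometry Literature.AlgebraicGeometry.Motives Literature.AlgebraicGeometry.Modules
open Literature.AlgebraicGeometry.HodgeTheory Literature.AlgebraicGeometry.KTheory
open Literature.AlgebraicGeometry.ModuliOfAbelianVarieties Literature.AlgebraicGeometry.Deligne1982
open Literature.AlgebraicGeometry.VanGeemen1994
open Literature.AlgebraicTopology.SingularHomology
open Literature.AlgebraicGeometry.Morphisms (EGAIV4_smoothAt_of_liftsAlongSmallExtensions_holds
  EGAIV_etaleQuasiSection_of_liftsSmallExtensions_holds)

namespace Summit.Ventures.HSemireg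

open Summit.HodgeConjecture.HodgeConjecture
open Summit.HodgeConjecture.HodgeConjecture.WeilTypeLadder
open Summit.HodgeConjecture.HodgeConjecture.Cruxes.HodgeAbelianVarieties.EStepSecantInduction
open Summit.HodgeConjecture.HodgeConjecture.Ring2.Hypotheses
open Summit.HodgeConjecture.HodgeConjecture.Ring2.AbelianAll
open Summit.Ventures.HSemireg.GeneralStructure

variable {C : ChernCharacterBetti}

/-! ## §1 Seeds from a census row, any level `N` — every binder a real carrier -/

section Seeds

/-- **Anchor packaging** (any object class `𝒪`, any level `N`): a complex abelian `2N`-fold `P` with `ψ₀ ≫ ψ₀ = -d`, a projective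
embedding `e` and rational `a ≠ 0` with `(P, ψ₀)` of SPLIT (hyperbolic) Weil type for `h_K = symmetrisedClass d P ψ₀ e a`, a non-zero
rational class `w` of the Weil plane, and a seed of class `𝒪` for `q·h_Kᴺ + w` ON `P` give `HasHyperbolicSeedOn 𝒪 N d` (the binders of
seat p7's predicate, assembled). [cite: vanGeemen1994HodgeAV, 5.2–5.4 (Weil type, hyperbolic = split)] -/
theorem hasHyperbolicSeedOn_of_hasSeedOn {𝒪 : ObjClass} {N d : ℕ}
    (P : AbelianVariety ℂ) (ψ₀ : P ⟶ P) (e : ProjectiveEmbedding P.X) (a : complexBetti (projectiveSpace e.n ℂ) 2)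
    (hP : P.dim = 2 * N) (hψ : ψ₀ ≫ ψ₀ = -(d • 𝟙 P)) (ha : IsRationalClass a) (ha0 : a ≠ 0)
    (hhyp : IsHyperbolicWeilType P ψ₀ N (symmetrisedClass d P ψ₀ e a))
    {w : complexBetti P.X (2 * N)} (hwW : w ∈ weilClassesOf P ψ₀ N d) (hwr : IsRationalClass w) (hw0 : w ≠ 0)
    (hS : HasSeedOn 𝒪 N P (symmetrisedClass d P ψ₀ e a) w) : HasHyperbolicSeedOn 𝒪 N d :=
  ⟨P, ψ₀, e, a, w, hP, hψ, ha, ha0, hhyp, hwW, hwr, hw0, hS⟩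

/-- **Rank-door seed from a census row, any level `N`** (seat p4's `rankObjClass C`): ON a complex abelian `2N`-fold `P` with a
degree-`2` class `h`, a finite set of Chern degrees `I ⊇ {1, …, 2N}`, ONE bounded complex of vector bundles `E` with
`Ext^{k}_{D(P)}(E,E) = 0` for `k < 0`, `Hom(E,E) = ℂ` (`extRank`, Mathlib's derived category of `𝒪_P`-modules) and
`rank Ext²(E,E) ≤ r(P, ch E)` (`contractionRank`, the polyvector contraction rank of the total Chern character in `Λ H¹(P)` —
[BuchweitzFlenner2008HH] Prop. 6.4.4's sufficient condition for FULL semiregularity, on paper), and rationals `q`, `c_p` with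
`ch_N(E) = q·hᴺ + w`, `ch_p(E) = c_p·hᵖ` for `p ∈ I ∖ {N}` ⟹ `HasSeedOn (rankObjClass C) N P h w`. (The abelian variety of the
admissibility clause is `P` itself, chart `Iso.refl`.) [cite: BuchweitzFlenner2008HH, Prop. 6.4.4]
[cite: Markman2025SecantWeil, §1.3 and Cor. 1.3.2 (the class shape; preprint)] -/
theorem hasSeedOn_rankObjClass_of_complex {N : ℕ} (hN : 1 ≤ N) (P : AbelianVariety ℂ) (hP : P.dim = 2 * N)
    (h : complexBetti P.X 2) (w : complexBetti P.X (2 * N))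
    (I : Finset ℕ) (hI : ∀ p : ℕ, 1 ≤ p → p ≤ 2 * N → p ∈ I) (E : CochainComplex P.X.left.Modules ℤ)
    (hE : IsBoundedVBComplex E) (hneg : ∀ k : ℤ, k < 0 → extRank P.X E k = 0) (h0 : extRank P.X E 0 = 1)
    (h2 : extRank P.X E 2 ≤ Cardinal.lift.{1} (contractionRank P fun p ↦ chPerfect C P.X E hE.isFiniteLocallyFree p))
    (q : ℚ) (c : ℕ → ℚ) (hchN : chPerfect C P.X E hE.isFiniteLocallyFree N = ((q : ℚ) : ℂ) • cupPowTwo h N + w)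
    (hchp : ∀ p ∈ I, p ≠ N → chPerfect C P.X E hE.isFiniteLocallyFree p = ((c p : ℚ) : ℂ) • cupPowTwo h p) :
    HasSeedOn (rankObjClass C) N P h w := by
  have hfun : (fun p ↦ complexBetti.map (Iso.refl P.X).hom (2 * p) (chPerfect C P.X E hE.isFiniteLocallyFree p)) =
      fun p ↦ chPerfect C P.X E hE.isFiniteLocallyFree p := by
    funext p
    rw [Iso.refl_hom, complexBetti.map_id]
    rfl
  have h2' : extRank P.X E 2 ≤ Cardinal.lift.{1} (contractionRank P fun p ↦
      complexBetti.map (Iso.refl P.X).hom (2 * p) (chPerfect C P.X E hE.isFiniteLocallyFree p)) := by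
    rw [hfun]
    exact h2
  have hAdm : rankAdmissible C (2 * N) P.X I E := ⟨hI, hneg, h0, P, Iso.refl P.X, hE, hP, h2'⟩
  exact ⟨I, fun p ↦ chPerfect C P.X E hE.isFiniteLocallyFree p, q, c, hI N hN (by omega), ⟨E, hE, hAdm, fun _ _ ↦ rfl⟩,
    hchN, hchp⟩

/-- **σ-door seed from a census row, any level `N`** (target seat t-7's `sigmaObjClass C`): as `hasSeedOn_rankObjClass_of_complex`,
with the rank clause replaced by the SEMIREGULARITY CERTIFICATE itself — `E` concentrated in `[a', b']` and `(σ_q(E))_{q+1 ∈ I}`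
JOINTLY INJECTIVE on `Ext²(E,E)` (`HomComplex.IsISemiregularC`, the real `σ_q` of `HomComplexSigma.lean`, [BuchweitzFlenner2003]
Def. 4.1 without the unit scalars `(-1)^q/q!`, in `D(Mod 𝒪_P)` for `HasDerivedCategory.standard`) ⟹ `HasSeedOn (sigmaObjClass C) N P h w`.
The binder `hσ` is BY VALUE (a census «σ-rank = dim Ext² on two codes»; no computation discharges it in the kernel).
[cite: BuchweitzFlenner2003, Def. 4.1 and §5 (I-semiregular)] [cite: Markman2025SecantWeil, §1.3 and Cor. 1.3.2 (the class shape; preprint)] -/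
theorem hasSeedOn_sigmaObjClass_of_complex {N : ℕ} (hN : 1 ≤ N) (P : AbelianVariety ℂ)
    (h : complexBetti P.X 2) (w : complexBetti P.X (2 * N))
    (I : Finset ℕ) (hI : ∀ p : ℕ, 1 ≤ p → p ≤ 2 * N → p ∈ I) (E : CochainComplex P.X.left.Modules ℤ)
    (hE : IsBoundedVBComplex E) (hneg : ∀ k : ℤ, k < 0 → extRank P.X E k = 0) (h0 : extRank P.X E 0 = 1)
    (a' b' : ℤ) [E.IsStrictlyGE a'] [E.IsStrictlyLE b']
    (hσ : letI := HasDerivedCategory.standard P.X.left.Modules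
      HomComplex.IsISemiregularC P.X E a' b' hE.isFiniteLocallyFree {q | q + 1 ∈ I})
    (q : ℚ) (c : ℕ → ℚ) (hchN : chPerfect C P.X E hE.isFiniteLocallyFree N = ((q : ℚ) : ℂ) • cupPowTwo h N + w)
    (hchp : ∀ p ∈ I, p ≠ N → chPerfect C P.X E hE.isFiniteLocallyFree p = ((c p : ℚ) : ℂ) • cupPowTwo h p) :
    HasSeedOn (sigmaObjClass C) N P h w :=
  ⟨I, fun p ↦ chPerfect C P.X E hE.isFiniteLocallyFree p, q, c, hI N hN (by omega),
    ⟨E, hE, ⟨hI, hneg, h0, a', b', inferInstance, inferInstance, hE.isFiniteLocallyFree, hσ⟩, fun _ _ ↦ rfl⟩, hchN, hchp⟩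

end Seeds

/-! ## §2 THE `g = 2N` CONDITIONAL THEOREM — route (C), rank door (TIER 2): split `2N`-folds, and the LADDER below -/

section RankDoor

/-- **The `g = 2N` conditional theorem, route (C), TIER 2 — every binder a real carrier** (STRUCTURE §3.0 «THE LADDER» / §3.1 (S-A),
kernel form; the case `N = 2` is seat p7's `weilFourfoldsSplit_of_reach_of_perfectComplexRankTransfer_of_complex`). BY NAME:
`weilFamilyReach_hyperbolic` (Deligne, REFEREED) and `PerfectComplexRankTransfer C` (the venture's ASSUMPTION for the real rank class; the
kernel links it to no source, F-1). BY VALUE: a complex abelian `2N`-fold `P` (`1 ≤ N`) with `ψ₀ ≫ ψ₀ = -d`, `0 < d`, of SPLIT Weil type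
for `h_K = symmetrisedClass d P ψ₀ e a` (`a ≠ 0` rational); a non-zero rational class `w` of its Weil plane; `I ⊇ {1, …, 2N}`; ONE bounded
complex of vector bundles `E` on `P.X` with `Ext^{<0}(E,E) = 0`, `Hom(E,E) = ℂ`, `rank Ext²(E,E) ≤ r(P, ch E)`; rationals `q`, `c_p`
with `ch_N(E) = q·h_Kᴺ + w`, `ch_p(E) = c_p·h_Kᵖ` off `N`. CONCLUSION: (i) `Stubs.WeilAlgebraicSplitHyperplane N d` — the Weil classes of
EVERY split `√-d`-Weil abelian `2N`-fold are algebraic; (ii) for every `2 ≤ n < N`, `WeilAlgebraicAll n d` — the Weil classes of EVERY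
`√-d`-Weil abelian `2n`-fold, of EVERY discriminant class (split and non-split), are algebraic (Schoen's product descent, PROVED in the
tree as `stub_descend`, iterated). In print only for `N ≤ 3` ([Markman2025SecantWeil] Thm. 1.5.1 / Cor. 1.6.1, preprint; JEMS 2023 for
`N = 2`); for `N ≥ 4` an implication with no printed instance and no census row ([Markman2025SurveySecant] §12: an expectation).
[cite: Deligne1982HodgeCycles, proof of Thm. 4.8] [cite: Schoen1998HodgeWeilAddendum, §10] [cite: BuchweitzFlenner2008HH, Prop. 6.4.4]
[cite: Perry2022, Prop. 8.1] [cite: Pridham2024Semiregularity, Cor. 2.25, Rem. 2.27] [cite: Markman2025SecantWeil, Thm. 1.5.1 and Cor. 1.6.1 (preprint)]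
[cite: Markman2025SurveySecant, §4, §11.5 Steps 1–2 and §12 (preprint)] -/
theorem ladder_of_reach_of_perfectComplexRankTransfer_of_complex (hF : weilFamilyReach_hyperbolic)
    (hT : PerfectComplexRankTransfer C) {N d : ℕ} (hN : 1 ≤ N) (hd : 0 < d)
    (P : AbelianVariety ℂ) (ψ₀ : P ⟶ P) (e : ProjectiveEmbedding P.X) (a : complexBetti (projectiveSpace e.n ℂ) 2)
    (hP : P.dim = 2 * N) (hψ : ψ₀ ≫ ψ₀ = -(d • 𝟙 P)) (ha : IsRationalClass a) (ha0 : a ≠ 0)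
    (hhyp : IsHyperbolicWeilType P ψ₀ N (symmetrisedClass d P ψ₀ e a))
    (w : complexBetti P.X (2 * N)) (hwW : w ∈ weilClassesOf P ψ₀ N d) (hwr : IsRationalClass w) (hw0 : w ≠ 0)
    (I : Finset ℕ) (hI : ∀ p : ℕ, 1 ≤ p → p ≤ 2 * N → p ∈ I) (E : CochainComplex P.X.left.Modules ℤ)
    (hE : IsBoundedVBComplex E) (hneg : ∀ k : ℤ, k < 0 → extRank P.X E k = 0) (h0 : extRank P.X E 0 = 1)
    (h2 : extRank P.X E 2 ≤ Cardinal.lift.{1} (contractionRank P fun p ↦ chPerfect C P.X E hE.isFiniteLocallyFree p))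
    (q : ℚ) (c : ℕ → ℚ)
    (hchN : chPerfect C P.X E hE.isFiniteLocallyFree N = ((q : ℚ) : ℂ) • cupPowTwo (symmetrisedClass d P ψ₀ e a) N + w)
    (hchp : ∀ p ∈ I, p ≠ N →
      chPerfect C P.X E hE.isFiniteLocallyFree p = ((c p : ℚ) : ℂ) • cupPowTwo (symmetrisedClass d P ψ₀ e a) p) :
    Stubs.WeilAlgebraicSplitHyperplane N d ∧ ∀ n : ℕ, 2 ≤ n → n < N → WeilAlgebraicAll n d := by
  have hS : HasHyperbolicSeedOn (rankObjClass C) N d :=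
    hasHyperbolicSeedOn_of_hasSeedOn P ψ₀ e a hP hψ ha ha0 hhyp hwW hwr hw0
      (hasSeedOn_rankObjClass_of_complex hN P hP _ w I hI E hE hneg h0 h2 q c hchN hchp)
  exact ⟨splitHyperplane_of_reach_of_localVariationalHodgeFor_of_hyperbolicSeedOn hF hN hd hT.localVariationalHodgeFor hS,
    fun n hn hnN ↦ weilAlgebraicAll_of_localVariationalHodgeFor_of_hyperbolicSeedOn_lt hF hT.localVariationalHodgeFor hS hn hnN hd⟩

/-- **… read cell by cell** (the census's row currency): under the same hypotheses every CELL `(n, K = ℚ(√-d), δ)`, `2 ≤ n < N`,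
`δ ∈ ℚˣ/Nm Kˣ` — the NON-SPLIT cells included — has its Weil classes algebraic: `WeilClassesComponent n d δ`.
[cite: Markman2025SecantWeil, §1.1 (the invariant (n, K, det H); preprint)] [cite: vanGeemen1994HodgeAV, 4.14 and Lemma 5.2]
[cite: Schoen1998HodgeWeilAddendum, §10] -/
theorem weilClassesComponent_lt_of_reach_of_perfectComplexRankTransfer_of_complex (hF : weilFamilyReach_hyperbolic)
    (hT : PerfectComplexRankTransfer C) {N d : ℕ} (hN : 1 ≤ N) (hd : 0 < d)
    (P : AbelianVariety ℂ) (ψ₀ : P ⟶ P) (e : ProjectiveEmbedding P.X) (a : complexBetti (projectiveSpace e.n ℂ) 2)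
    (hP : P.dim = 2 * N) (hψ : ψ₀ ≫ ψ₀ = -(d • 𝟙 P)) (ha : IsRationalClass a) (ha0 : a ≠ 0)
    (hhyp : IsHyperbolicWeilType P ψ₀ N (symmetrisedClass d P ψ₀ e a))
    (w : complexBetti P.X (2 * N)) (hwW : w ∈ weilClassesOf P ψ₀ N d) (hwr : IsRationalClass w) (hw0 : w ≠ 0)
    (I : Finset ℕ) (hI : ∀ p : ℕ, 1 ≤ p → p ≤ 2 * N → p ∈ I) (E : CochainComplex P.X.left.Modules ℤ)
    (hE : IsBoundedVBComplex E) (hneg : ∀ k : ℤ, k < 0 → extRank P.X E k = 0) (h0 : extRank P.X E 0 = 1)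
    (h2 : extRank P.X E 2 ≤ Cardinal.lift.{1} (contractionRank P fun p ↦ chPerfect C P.X E hE.isFiniteLocallyFree p))
    (q : ℚ) (c : ℕ → ℚ)
    (hchN : chPerfect C P.X E hE.isFiniteLocallyFree N = ((q : ℚ) : ℂ) • cupPowTwo (symmetrisedClass d P ψ₀ e a) N + w)
    (hchp : ∀ p ∈ I, p ≠ N →
      chPerfect C P.X E hE.isFiniteLocallyFree p = ((c p : ℚ) : ℂ) • cupPowTwo (symmetrisedClass d P ψ₀ e a) p)
    {n : ℕ} (hn : 2 ≤ n) (hnN : n < N) (δ : weilNormResidueGroup d) : WeilClassesComponent n d δ :=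
  weilClassesComponent_of_weilAlgebraicAll
    ((ladder_of_reach_of_perfectComplexRankTransfer_of_complex hF hT hN hd P ψ₀ e a hP hψ ha ha0 hhyp w hwW hwr hw0 I hI E hE hneg
      h0 h2 q c hchN hchp).2 n hn hnN) δ

/-- **DECIDING-ROW form, any cell `(N, d, δ)`** (a member of a NON-split component is what decides at its own `g`; the `g = 6` case is
`ComponentCellsRouteC.weilSixfoldComponent_of_perfectComplexRankTransfer_of_seedOn_member`, here unbundled and at every level). BY NAME:
Deligne's reach-by-similitude `weilFamilyReach_similar` (REFEREED) and `PerfectComplexRankTransfer C` (ASSUMPTION). BY VALUE: a polarized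
member `(P, ψ₀, h_K)` of Weil type `(N, d)` of the cell `δ` (rational Gram placement `HasWeilDiscriminantNondeg`), a non-zero rational Weil
class `w`, and the rank-door row on it (binders of `hasSeedOn_rankObjClass_of_complex`) ⟹ `WeilClassesComponent N d δ`: the Weil classes of
EVERY member of that component are algebraic. VERDICT-G6 v1.0: at `g = 6` no object of the census supplies these binders on a non-split
component («NO-in-families-tried»; «STRUCTURAL-NO not claimed»). [cite: Deligne1982HodgeCycles, proof of Thm. 4.8]
[cite: vanGeemen1994HodgeAV, Lemma 5.2 (3)–(4) and Thm. 5.3] [cite: BuchweitzFlenner2008HH, Prop. 6.4.4] [cite: Perry2022, Prop. 8.1] -/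
theorem weilClassesComponent_of_perfectComplexRankTransfer_of_complex {N d : ℕ} {δ : weilNormResidueGroup d}
    (hF : weilFamilyReach_similar) (hT : PerfectComplexRankTransfer C)
    {P : AbelianVariety ℂ} {ψ₀ : P ⟶ P} (hW : IsWeilType P ψ₀ N d) (e : ProjectiveEmbedding P.X)
    {a : complexBetti (projectiveSpace e.n ℂ) 2} (haQ : IsRationalClass a) (ha0 : a ≠ 0)
    (hδ : HasWeilDiscriminantNondeg P ψ₀ N d (symmetrisedClass d P ψ₀ e a) δ)
    (w : complexBetti P.X (2 * N)) (hwW : w ∈ weilClassesOf P ψ₀ N d) (hwQ : IsRationalClass w) (hw0 : w ≠ 0)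
    (I : Finset ℕ) (hI : ∀ p : ℕ, 1 ≤ p → p ≤ 2 * N → p ∈ I) (E : CochainComplex P.X.left.Modules ℤ)
    (hE : IsBoundedVBComplex E) (hneg : ∀ k : ℤ, k < 0 → extRank P.X E k = 0) (h0 : extRank P.X E 0 = 1)
    (h2 : extRank P.X E 2 ≤ Cardinal.lift.{1} (contractionRank P fun p ↦ chPerfect C P.X E hE.isFiniteLocallyFree p))
    (q : ℚ) (c : ℕ → ℚ)
    (hchN : chPerfect C P.X E hE.isFiniteLocallyFree N = ((q : ℚ) : ℂ) • cupPowTwo (symmetrisedClass d P ψ₀ e a) N + w)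
    (hchp : ∀ p ∈ I, p ≠ N →
      chPerfect C P.X E hE.isFiniteLocallyFree p = ((c p : ℚ) : ℂ) • cupPowTwo (symmetrisedClass d P ψ₀ e a) p) :
    WeilClassesComponent N d δ :=
  weilClassesComponent_of_perfectComplexRankTransfer_of_seedOn_member C hF hT hW e haQ ha0 hδ hwW hwQ hw0
    (hasSeedOn_rankObjClass_of_complex hW.pos P hW.dim_eq _ w I hI E hE hneg h0 h2 q c hchN hchp)

end RankDoor

/-! ## §3 The same over the σ-door (the certificate is SEMIREGULARITY itself, on target seat t-7's real carrier) -/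

section SigmaDoor

/-- **The `g = 2N` conditional theorem, route (C), σ-door — every binder a real carrier** (the case `N = 2` is t-7's
`weilFourfoldsSplit_of_reach_of_perfectComplexSigmaTransfer_of_complex`). BY NAME: `weilFamilyReach_hyperbolic` (REFEREED) and
`PerfectComplexSigmaTransfer C` (ASSUMPTION of the venture; printed object hypothesis «`E` semiregular, `Ext^{<0}(E,E) = 0`» —
Perry arXiv:2604.00511 Thm. 1.1, preprint; refereed chain [Perry2022] Prop. 8.1 + [Lieblich2006] 4.2.1 + [Pridham2024Semiregularity]
Cor. 2.25 / Rem. 2.27 / Rem. 2.21 + [BuchweitzFlenner2003] Rem. 4.7 (1) + [Deligne1968] 5.5; no kernel link). BY VALUE: the split anchor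
`(P, ψ₀, e, a)` at level `N`, `w`, `I ⊇ {1, …, 2N}`, ONE bounded complex of vector bundles `E` on `P.X` in `[a', b']` with
`Ext^{<0}(E,E) = 0`, `Hom(E,E) = ℂ` and `(σ_q(E))_{q+1 ∈ I}` JOINTLY INJECTIVE (`HomComplex.IsISemiregularC`), Chern data of Markman's
shape. CONCLUSION: `Stubs.WeilAlgebraicSplitHyperplane N d ∧ ∀ n, 2 ≤ n < N → WeilAlgebraicAll n d`.
[claim: Perry2026Semiregularity, status: under-review] [cite: Perry2022, Prop. 8.1] [cite: Pridham2024Semiregularity, Cor. 2.25, Rem. 2.27]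
[cite: BuchweitzFlenner2003, Def. 4.1 and §5 (I-semiregular)] [cite: Deligne1982HodgeCycles, proof of Thm. 4.8] [cite: Schoen1998HodgeWeilAddendum, §10] -/
theorem ladder_of_reach_of_perfectComplexSigmaTransfer_of_complex (hF : weilFamilyReach_hyperbolic)
    (hT : PerfectComplexSigmaTransfer C) {N d : ℕ} (hN : 1 ≤ N) (hd : 0 < d)
    (P : AbelianVariety ℂ) (ψ₀ : P ⟶ P) (e : ProjectiveEmbedding P.X) (a : complexBetti (projectiveSpace e.n ℂ) 2)
    (hP : P.dim = 2 * N) (hψ : ψ₀ ≫ ψ₀ = -(d • 𝟙 P)) (ha : IsRationalClass a) (ha0 : a ≠ 0)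
    (hhyp : IsHyperbolicWeilType P ψ₀ N (symmetrisedClass d P ψ₀ e a))
    (w : complexBetti P.X (2 * N)) (hwW : w ∈ weilClassesOf P ψ₀ N d) (hwr : IsRationalClass w) (hw0 : w ≠ 0)
    (I : Finset ℕ) (hI : ∀ p : ℕ, 1 ≤ p → p ≤ 2 * N → p ∈ I) (E : CochainComplex P.X.left.Modules ℤ)
    (hE : IsBoundedVBComplex E) (hneg : ∀ k : ℤ, k < 0 → extRank P.X E k = 0) (h0 : extRank P.X E 0 = 1)
    (a' b' : ℤ) [E.IsStrictlyGE a'] [E.IsStrictlyLE b']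
    (hσ : letI := HasDerivedCategory.standard P.X.left.Modules
      HomComplex.IsISemiregularC P.X E a' b' hE.isFiniteLocallyFree {q | q + 1 ∈ I})
    (q : ℚ) (c : ℕ → ℚ)
    (hchN : chPerfect C P.X E hE.isFiniteLocallyFree N = ((q : ℚ) : ℂ) • cupPowTwo (symmetrisedClass d P ψ₀ e a) N + w)
    (hchp : ∀ p ∈ I, p ≠ N →
      chPerfect C P.X E hE.isFiniteLocallyFree p = ((c p : ℚ) : ℂ) • cupPowTwo (symmetrisedClass d P ψ₀ e a) p) :
    Stubs.WeilAlgebraicSplitHyperplane N d ∧ ∀ n : ℕ, 2 ≤ n → n < N → WeilAlgebraicAll n d := by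
  have hS : HasHyperbolicSeedOn (sigmaObjClass C) N d :=
    hasHyperbolicSeedOn_of_hasSeedOn P ψ₀ e a hP hψ ha ha0 hhyp hwW hwr hw0
      (hasSeedOn_sigmaObjClass_of_complex hN P _ w I hI E hE hneg h0 a' b' hσ q c hchN hchp)
  exact ⟨splitHyperplane_of_reach_of_localVariationalHodgeFor_of_hyperbolicSeedOn hF hN hd hT.localVariationalHodgeFor hS,
    fun n hn hnN ↦ weilAlgebraicAll_of_localVariationalHodgeFor_of_hyperbolicSeedOn_lt hF hT.localVariationalHodgeFor hS hn hnN hd⟩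

/-- **DECIDING-ROW form over the σ-door, any cell `(N, d, δ)`** (t-7's `weilSixfoldComponent_of_perfectComplexSigmaTransfer_of_complex`
at every level): BY NAME `weilFamilyReach_similar` (REFEREED) and `PerfectComplexSigmaTransfer C` (ASSUMPTION); BY VALUE a polarized
Weil-type `(N, d)` member of the cell `δ`, `w`, and the σ-door row on it ⟹ `WeilClassesComponent N d δ`. No census row supplies these
binders on a deciding component (VERDICT-G6 v1.0). [claim: Perry2026Semiregularity, status: under-review] [cite: Perry2022, Prop. 8.1]
[cite: BuchweitzFlenner2003, Def. 4.1 and §5 (I-semiregular)] [cite: Deligne1982HodgeCycles, proof of Thm. 4.8]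
[cite: vanGeemen1994HodgeAV, Lemma 5.2 (3)–(4) and Thm. 5.3] -/
theorem weilClassesComponent_of_perfectComplexSigmaTransfer_of_complex {N d : ℕ} {δ : weilNormResidueGroup d}
    (hF : weilFamilyReach_similar) (hT : PerfectComplexSigmaTransfer C)
    {P : AbelianVariety ℂ} {ψ₀ : P ⟶ P} (hW : IsWeilType P ψ₀ N d) (e : ProjectiveEmbedding P.X)
    {a : complexBetti (projectiveSpace e.n ℂ) 2} (haQ : IsRationalClass a) (ha0 : a ≠ 0)
    (hδ : HasWeilDiscriminantNondeg P ψ₀ N d (symmetrisedClass d P ψ₀ e a) δ)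
    (w : complexBetti P.X (2 * N)) (hwW : w ∈ weilClassesOf P ψ₀ N d) (hwQ : IsRationalClass w) (hw0 : w ≠ 0)
    (I : Finset ℕ) (hI : ∀ p : ℕ, 1 ≤ p → p ≤ 2 * N → p ∈ I) (E : CochainComplex P.X.left.Modules ℤ)
    (hE : IsBoundedVBComplex E) (hneg : ∀ k : ℤ, k < 0 → extRank P.X E k = 0) (h0 : extRank P.X E 0 = 1)
    (a' b' : ℤ) [E.IsStrictlyGE a'] [E.IsStrictlyLE b']
    (hσ : letI := HasDerivedCategory.standard P.X.left.Modules
      HomComplex.IsISemiregularC P.X E a' b' hE.isFiniteLocallyFree {q | q + 1 ∈ I})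
    (q : ℚ) (c : ℕ → ℚ)
    (hchN : chPerfect C P.X E hE.isFiniteLocallyFree N = ((q : ℚ) : ℂ) • cupPowTwo (symmetrisedClass d P ψ₀ e a) N + w)
    (hchp : ∀ p ∈ I, p ≠ N →
      chPerfect C P.X E hE.isFiniteLocallyFree p = ((c p : ℚ) : ℂ) • cupPowTwo (symmetrisedClass d P ψ₀ e a) p) :
    WeilClassesComponent N d δ :=
  weilClassesComponent_of_perfectComplexSigmaTransfer_of_seedOn_member C hF hT hW e haQ ha0 hδ hwW hwQ hw0
    (hasSeedOn_sigmaObjClass_of_complex hW.pos P _ w I hI E hE hneg h0 a' b' hσ q c hchN hchp)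

end SigmaDoor

/-! ## §4 The same on rung R5 of the trust-base ladder: reach ∧ (F) `PridhamPerfectLifts C` ∧ Lieblich-type versal charts — nothing else -/

section RungR5

/-- **The `g = 2N` conditional theorem on rung R5** (the case `N = 2` is seat p7's
`weilFourfoldsSplit_of_reach_of_pridhamPerfect_of_versalCharts_of_hyperbolicSeedOn` / `…_of_local_ff_single`). BY NAME — and NOTHING ELSE:
`weilFamilyReach_hyperbolic` (Deligne, REFEREED tree fact); `PridhamPerfectLifts C` (the PRINTED, REFEREED statement [Pridham2024Semiregularity]
Cor. 2.25 + Rem. 2.27 + Rem. 2.21 + Lemma 1.8–1.9 for strictly perfect complexes, typed VENTURE-side on t-7's real `σ`-carrier, undischarged);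
Lieblich-type VERSAL CHARTS `hV` (`HasVersalPerfectChartAt` for every universally gluable bounded complex of vector bundles on every smooth
projective family over a smooth base — assumption by name, its versality clause in EXISTENCE form, weaker than the formal smoothness of a
Lieblich atlas, red-5 W-14). [EGAIV4] Prop. (17.14.2) / Cor. (17.16.3) (i) are lit-3's THEOREMS (`EGAIV4_smoothAt_of_liftsAlongSmallExtensions_holds`,
`EGAIV_etaleQuasiSection_of_liftsSmallExtensions_holds` in `Literature/AlgebraicGeometry/Morphisms/EtaleQuasiSectionOfFormallySmooth.lean`) and th-3's glue
`perfectComplexAlgebraisesLifts_of_versalCharts`, p7's split `perfectComplexSigmaTransfer_of_pridhamPerfect_of_algebraisesLifts` are KERNEL.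
BY VALUE: the σ-door row of §3. CONCLUSION: `Stubs.WeilAlgebraicSplitHyperplane N d ∧ ∀ n, 2 ≤ n < N → WeilAlgebraicAll n d`.
[cite: Pridham2024Semiregularity, Cor. 2.25; Rem. 2.27; Rem. 2.21; Lemma 1.8–1.9] [cite: Lieblich2006, Thm. 4.2.1 and Prop. 2.1.9]
[cite: EGAIV4, Prop. (17.14.2), p. 98, and Cor. (17.16.3) (i), p. 106] [cite: Perry2022, proof of Prop. 8.1]
[cite: Deligne1982HodgeCycles, proof of Thm. 4.8] [cite: Schoen1998HodgeWeilAddendum, §10] -/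
theorem ladder_of_reach_of_pridhamPerfect_of_versalCharts_of_complex
    (hF : weilFamilyReach_hyperbolic) (hP : PridhamPerfectLifts C)
    (hV : ∀ ⦃𝒳 S : SchemeOver ℂ⦄ (π : 𝒳 ⟶ S) (n : ℕ),
      IsSmoothProjectiveFamily π n → _root_.AlgebraicGeometry.Smooth S.hom →
      ∀ (s₀ : ComplexPoints S) (X₀ : SchemeOver ℂ) (e : X₀ ≅ fiberOver π s₀)
        (E : CochainComplex X₀.left.Modules ℤ), IsBoundedVBComplex E →
        (∀ k : ℤ, k < 0 → extRank X₀ E k = 0) → HasVersalPerfectChartAt π s₀ X₀ e E)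
    {N d : ℕ} (hN : 1 ≤ N) (hd : 0 < d)
    (P : AbelianVariety ℂ) (ψ₀ : P ⟶ P) (e : ProjectiveEmbedding P.X) (a : complexBetti (projectiveSpace e.n ℂ) 2)
    (hP2N : P.dim = 2 * N) (hψ : ψ₀ ≫ ψ₀ = -(d • 𝟙 P)) (ha : IsRationalClass a) (ha0 : a ≠ 0)
    (hhyp : IsHyperbolicWeilType P ψ₀ N (symmetrisedClass d P ψ₀ e a))
    (w : complexBetti P.X (2 * N)) (hwW : w ∈ weilClassesOf P ψ₀ N d) (hwr : IsRationalClass w) (hw0 : w ≠ 0)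
    (I : Finset ℕ) (hI : ∀ p : ℕ, 1 ≤ p → p ≤ 2 * N → p ∈ I) (E : CochainComplex P.X.left.Modules ℤ)
    (hE : IsBoundedVBComplex E) (hneg : ∀ k : ℤ, k < 0 → extRank P.X E k = 0) (h0 : extRank P.X E 0 = 1)
    (a' b' : ℤ) [E.IsStrictlyGE a'] [E.IsStrictlyLE b']
    (hσ : letI := HasDerivedCategory.standard P.X.left.Modules
      HomComplex.IsISemiregularC P.X E a' b' hE.isFiniteLocallyFree {q | q + 1 ∈ I})
    (q : ℚ) (c : ℕ → ℚ)
    (hchN : chPerfect C P.X E hE.isFiniteLocallyFree N = ((q : ℚ) : ℂ) • cupPowTwo (symmetrisedClass d P ψ₀ e a) N + w)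
    (hchp : ∀ p ∈ I, p ≠ N →
      chPerfect C P.X E hE.isFiniteLocallyFree p = ((c p : ℚ) : ℂ) • cupPowTwo (symmetrisedClass d P ψ₀ e a) p) :
    Stubs.WeilAlgebraicSplitHyperplane N d ∧ ∀ n : ℕ, 2 ≤ n → n < N → WeilAlgebraicAll n d :=
  ladder_of_reach_of_perfectComplexSigmaTransfer_of_complex hF
    (perfectComplexSigmaTransfer_of_pridhamPerfect_of_algebraisesLifts hP (perfectComplexAlgebraisesLifts_of_versalCharts hV C))
    hN hd P ψ₀ e a hP2N hψ ha ha0 hhyp w hwW hwr hw0 I hI E hE hneg h0 a' b' hσ q c hchN hchp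

/-- **Rung R5, bundled seed, any level**: reach ∧ (F) `PridhamPerfectLifts C` ∧ versal charts ∧ `HasHyperbolicSeedOn (sigmaObjClass C) N d`
⟹ `Stubs.WeilAlgebraicSplitHyperplane N d ∧ ∀ n, 2 ≤ n < N → WeilAlgebraicAll n d`; EGA IV 17 discharged in the kernel.
[cite: Pridham2024Semiregularity, Cor. 2.25; Rem. 2.27] [cite: Lieblich2006, Thm. 4.2.1] [cite: EGAIV4, Prop. (17.14.2), p. 98]
[cite: Deligne1982HodgeCycles, proof of Thm. 4.8] [cite: Schoen1998HodgeWeilAddendum, §10] -/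
theorem ladder_of_reach_of_pridhamPerfect_of_versalCharts_of_hyperbolicSeedOn
    (hF : weilFamilyReach_hyperbolic) (hP : PridhamPerfectLifts C)
    (hV : ∀ ⦃𝒳 S : SchemeOver ℂ⦄ (π : 𝒳 ⟶ S) (n : ℕ),
      IsSmoothProjectiveFamily π n → _root_.AlgebraicGeometry.Smooth S.hom →
      ∀ (s₀ : ComplexPoints S) (X₀ : SchemeOver ℂ) (e : X₀ ≅ fiberOver π s₀)
        (E : CochainComplex X₀.left.Modules ℤ), IsBoundedVBComplex E →
        (∀ k : ℤ, k < 0 → extRank X₀ E k = 0) → HasVersalPerfectChartAt π s₀ X₀ e E)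
    {N d : ℕ} (hN : 1 ≤ N) (hd : 0 < d) (hS : HasHyperbolicSeedOn (sigmaObjClass C) N d) :
    Stubs.WeilAlgebraicSplitHyperplane N d ∧ ∀ n : ℕ, 2 ≤ n → n < N → WeilAlgebraicAll n d :=
  have hT : PerfectComplexSigmaTransfer C :=
    perfectComplexSigmaTransfer_of_pridhamPerfect_of_algebraisesLifts hP (perfectComplexAlgebraisesLifts_of_versalCharts hV C)
  ⟨splitHyperplane_of_reach_of_localVariationalHodgeFor_of_hyperbolicSeedOn hF hN hd hT.localVariationalHodgeFor hS,
    fun _ hn hnN ↦ weilAlgebraicAll_of_localVariationalHodgeFor_of_hyperbolicSeedOn_lt hF hT.localVariationalHodgeFor hS hn hnN hd⟩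

end RungR5

/-! ## §5 The functor-free `Ext`-transport variant of the rank-door seed (the census computes `Ext^•` on a SOURCE object) -/

section ExtTransport

/-- **Rank-door seed with the `Ext` clauses on a SOURCE object `G`** (any level; functor-free, red-5 V16 shape of seat p7's `g = 4`
`…_of_extRank_eq`): the row of `hasSeedOn_rankObjClass_of_complex` where `Ext^{<0} = 0`, `Hom = ℂ` and the rank clause are stated on a
cochain complex `G` over another `ℂ`-scheme `Y₀` (the object the engines computed on, e.g. `I_Z[0]` on `X × X` before a Fourier–Mukai
functor) together with the bare equalities `extRank P.X E m = extRank Y₀ G m` in the degrees used, `m ≤ 2` (what a derived equivalence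
gives — `DerivedEquivalenceExtRank.lean`, `AmplificationChainG4Transport.extRank_eq_of_local_ff`; by value here).
[cite: BuchweitzFlenner2008HH, Prop. 6.4.4] [cite: Orlov2002DerivedAbelian, Assertion 2.8] [cite: GortzWedhorn2023, Thm. 22.42] -/
theorem hasSeedOn_rankObjClass_of_extRank_eq {N : ℕ} (hN : 1 ≤ N) (P : AbelianVariety ℂ) (hP : P.dim = 2 * N)
    (h : complexBetti P.X 2) (w : complexBetti P.X (2 * N))
    (I : Finset ℕ) (hI : ∀ p : ℕ, 1 ≤ p → p ≤ 2 * N → p ∈ I) (E : CochainComplex P.X.left.Modules ℤ)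
    (hE : IsBoundedVBComplex E) (q : ℚ) (c : ℕ → ℚ)
    (hchN : chPerfect C P.X E hE.isFiniteLocallyFree N = ((q : ℚ) : ℂ) • cupPowTwo h N + w)
    (hchp : ∀ p ∈ I, p ≠ N → chPerfect C P.X E hE.isFiniteLocallyFree p = ((c p : ℚ) : ℂ) • cupPowTwo h p)
    {Y₀ : SchemeOver ℂ} (G : CochainComplex Y₀.left.Modules ℤ)
    (hext : ∀ m : ℤ, m ≤ 2 → extRank P.X E m = extRank Y₀ G m)
    (hneg : ∀ k : ℤ, k < 0 → extRank Y₀ G k = 0) (h0 : extRank Y₀ G 0 = 1)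
    (h2 : extRank Y₀ G 2 ≤ Cardinal.lift.{1} (contractionRank P fun p ↦ chPerfect C P.X E hE.isFiniteLocallyFree p)) :
    HasSeedOn (rankObjClass C) N P h w :=
  hasSeedOn_rankObjClass_of_complex hN P hP h w I hI E hE (fun k hk ↦ (hext k (by omega)).trans (hneg k hk))
    ((hext 0 (by norm_num)).trans h0) ((hext 2 le_rfl).symm ▸ h2) q c hchN hchp

end ExtTransport

/-! ## Audit: nothing is decided here
Every theorem with a Weil conclusion carries a SEED by value (the object `E` with its `Ext` clauses and its rank / σ certificate and its
Chern data — the cell's computation targets; by VERDICT-G6 v1.0 no row of the census supplies them on a deciding component) AND the transfer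
statement for the same class BY NAME (`PerfectComplexRankTransfer C` / `PerfectComplexSigmaTransfer C` — assumptions of the venture, no
kernel link to Pridham / Perry / BF 2008 — or, on rung R5, `PridhamPerfectLifts C` ∧ Lieblich-type versal charts), plus the refereed reach
fact (`weilFamilyReach_hyperbolic` / `weilFamilyReach_similar`). `HC_CM`, CM density / André–Oort, Mumford–Tate finiteness, Grothendieck
existence as a separate input do not occur. 0 `def`, 0 named fact, 0 `sorry`. -/

end Summit.Ventures.HSemireg

end
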